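import Literature.AlgebraicGeometry.KTheory.EulerCharacteristic
import HarnessLib

/-!
# Pull-back preserves acyclicity and quasi-isomorphisms of bounded complexes of vector bundles

For a morphism of schemes `f : Y ⟶ X`, the pull-back `f^*` of `𝒪`-modules is only right exact, but on
the exact category `Vect(X)` of vector bundles it is EXACT (tree: `KTheory.shortExact_map_pullback`,
`KTheory/PullbackVectorBundle`). Consequently (this file):

* `IsBoundedVBComplex.acyclic_pullback` — the pull-back of an ACYCLIC bounded complex of vector bundles
  is acyclic: its cycles `Zⁱ` are vector bundles and `0 → Zⁱ → Kⁱ → Zⁱ⁺¹ → 0` is short exact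
  (`KTheory/EulerCharacteristic`), `f^*` keeps these short exact, and `f^*dⁱ = f^*(Kⁱ ↠ Zⁱ⁺¹) ≫ f^*(Zⁱ⁺¹ ↣ Kⁱ⁺¹)`;
* `quasiIso_iff_acyclic_mappingCone` — in an abelian category a morphism of cochain complexes is a
  quasi-isomorphism iff its mapping cone is acyclic (Mathlib's
  `HomotopyCategory.quasiIso_eq_trW_subcategoryAcyclic`, unpacked);
* `IsBoundedVBComplex.quasiIso_pullback_map` — **`f^*` preserves quasi-isomorphisms between bounded
  complexes of vector bundles** (`f^*Cone(φ) ≅ Cone(f^*φ)`, Mathlib's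
  `CochainComplex.mappingCone.mapHomologicalComplexIso`).

This is the statement that an exact functor between exact categories (here `f^* : Vect(X) → Vect(Y)`)
preserves (strictly) acyclic bounded complexes and hence quasi-isomorphisms in the sense of
Schlichting §3.1.3 / Grayson (used implicitly in Grayson's Definition 1, where `F` is applied to
complexes and `u : FM → N` is required to be a quasi-isomorphism); on bounded complexes of vector
bundles the naive pull-back is the derived one. Everything is proved; no named facts.

## References

* M. Schlichting, *Higher algebraic K-theory*, LNM 2008 (2011), §3.1.3. [Schlichting2011HigherKTheory]
* D. R. Grayson, arXiv:1310.8644, §1. [Grayson2013RelativeKTheory]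
-/

universe u

open CategoryTheory CategoryTheory.Limits AlgebraicGeometry
open Literature.AlgebraicGeometry.Motives

noncomputable section

namespace Literature.AlgebraicGeometry.KTheory

/-! ## Quasi-isomorphisms and acyclic cones -/

/-- In an abelian category, a morphism of cochain complexes is a quasi-isomorphism iff its mapping cone
is acyclic. [cite: Schlichting2011HigherKTheory, §3.1.3] -/
theorem quasiIso_iff_acyclic_mappingCone {C : Type*} [Category C] [Abelian C]
    {K L : CochainComplex C ℤ} (φ : K ⟶ L) :
    QuasiIso φ ↔ (CochainComplex.mappingCone φ).Acyclic := by
  rw [← HomotopyCategory.quotient_obj_mem_subcategoryAcyclic_iff_acyclic,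
    ← HomologicalComplex.mem_quasiIso_iff, ← HomotopyCategory.quotient_map_mem_quasiIso_iff,
    HomotopyCategory.quasiIso_eq_trW_subcategoryAcyclic]
  exact ObjectProperty.trW_iff_of_distinguished _ _
    (HomotopyCategory.mappingCone_triangleh_distinguished φ)

/-! ## Cycles with flexible indices -/

section Kernels

variable {C : Type*} [Category C] [Abelian C] (K : CochainComplex C ℤ)

/-- The short complex `Zⁱ → Kⁱ → Zʲ` for consecutive degrees `i + 1 = j`, `j + 1 = k` (`Zⁱ = ker(dⁱ : Kⁱ → Kʲ)`,
`Zʲ = ker(Kʲ → Kᵏ)`), with the indices as free variables (cf. `kernelShortComplex`). [folklore] -/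
abbrev kernelShortComplex' (i j k : ℤ) : ShortComplex C :=
  ShortComplex.mk (kernel.ι (K.d i j)) (kernel.lift (K.d j k) (K.d i j) (K.d_comp_d _ _ _))
    (by rw [← cancel_mono (kernel.ι _), Category.assoc, kernel.lift_ι, kernel.condition, zero_comp])

variable {K}

/-- `0 → Zⁱ → Kⁱ → Zʲ → 0` is short exact for an acyclic complex (`i + 1 = j`, `j + 1 = k`). [folklore] -/
theorem shortExact_kernel_of_acyclic' (hac : K.Acyclic) (i j k : ℤ) (hij : i + 1 = j)
    (hjk : j + 1 = k) : (kernelShortComplex' K i j k).ShortExact := by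
  have hepi : Epi (kernel.lift (K.d j k) (K.d i j) (K.d_comp_d _ _ _)) :=
    ((K.exactAt_iff' i j k (by simp [← hij]) (by simp [hjk])).1 (hac j)).epi_kernelLift
  refine ShortComplex.ShortExact.mk' ?_ inferInstance hepi
  have hex : (ShortComplex.mk (kernel.ι (K.d i j)) (K.d i j) (kernel.condition _)).Exact :=
    ShortComplex.kernelSequence_exact _
  exact (exact_iff_of_epi_iso_mono (S₁ := kernelShortComplex' K i j k)
    (S₂ := ShortComplex.mk (kernel.ι (K.d i j)) (K.d i j) (kernel.condition _))
    (𝟙 _) (Iso.refl _) (kernel.ι (K.d j k)) (by simp) (by simp)).2 hex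

end Kernels

/-! ## Pull-back of acyclic bounded complexes of vector bundles -/

namespace IsBoundedVBComplex

variable {X Y : Scheme.{u}} (f : Y ⟶ X) {K L : CochainComplex X.Modules ℤ}

/-- The cycles of an acyclic bounded complex of vector bundles are vector bundles (flexible indices).
[folklore] -/
theorem isFiniteLocallyFree_kernel' (hK : IsBoundedVBComplex K) (hac : K.Acyclic) (i j : ℤ)
    (hij : i + 1 = j) : IsFiniteLocallyFree (kernel (K.d i j)) := by
  subst hij
  exact hK.isFiniteLocallyFree_kernel hac i

/-- **The pull-back of an acyclic bounded complex of vector bundles is acyclic.** With `Zⁱ = ker dⁱ`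
(vector bundles) the sequences `0 → Zⁱ → Kⁱ → Zⁱ⁺¹ → 0` are short exact and stay so after `f^*`
(`shortExact_map_pullback`, `f^*` being exact on vector bundles); since `f^*dⁱ⁻¹` is the epimorphism
`f^*Kⁱ⁻¹ → f^*Zⁱ` followed by `f^*Zⁱ → f^*Kⁱ`, and `f^*dⁱ` is `f^*Kⁱ → f^*Zⁱ⁺¹` followed by the
monomorphism `f^*Zⁱ⁺¹ → f^*Kⁱ⁺¹`, exactness of `f^*K` at `i` is that of `0 → f^*Zⁱ → f^*Kⁱ → f^*Zⁱ⁺¹ → 0`.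
[cite: Schlichting2011HigherKTheory, §3.1.3] -/
theorem acyclic_pullback (hK : IsBoundedVBComplex K) (hac : K.Acyclic) :
    (((Scheme.Modules.pullback f).mapHomologicalComplex (ComplexShape.up ℤ)).obj K).Acyclic := by
  intro j
  let F := Scheme.Modules.pullback f
  -- the pulled-back short exact sequences
  have hS : ∀ (a b c : ℤ), a + 1 = b → b + 1 = c →
      ((kernelShortComplex' K a b c).map F).ShortExact := fun a b c hab hbc ↦
    shortExact_map_pullback f (shortExact_kernel_of_acyclic' hac a b c hab hbc)
      (hK.isFiniteLocallyFree_kernel' hac b c hbc)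
  have hepi : Epi (F.map (kernel.lift (K.d j (j + 1)) (K.d (j - 1) j) (K.d_comp_d _ _ _))) :=
    (hS (j - 1) j (j + 1) (by ring) rfl).epi_g
  have hmono : Mono (F.map (kernel.ι (K.d (j + 1) (j + 1 + 1)))) :=
    (hS (j + 1) (j + 1 + 1) (j + 1 + 1 + 1) rfl rfl).mono_f
  -- the three short complexes `A = (f^*ιʲ, f^*πʲ)`, `B = (f^*πʲ⁻¹ ≫ f^*ιʲ, f^*πʲ)`, `C = (f^*dʲ⁻¹, f^*dʲ)`
  have zA : F.map (kernel.ι (K.d j (j + 1))) ≫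
      F.map (kernel.lift (K.d (j + 1) (j + 1 + 1)) (K.d j (j + 1)) (K.d_comp_d _ _ _)) = 0 := by
    rw [← F.map_comp, (kernelShortComplex' K j (j + 1) (j + 1 + 1)).zero, F.map_zero]
  have zB : (F.map (kernel.lift (K.d j (j + 1)) (K.d (j - 1) j) (K.d_comp_d _ _ _)) ≫
      F.map (kernel.ι (K.d j (j + 1)))) ≫
      F.map (kernel.lift (K.d (j + 1) (j + 1 + 1)) (K.d j (j + 1)) (K.d_comp_d _ _ _)) = 0 := by
    rw [Category.assoc, zA, comp_zero]
  have zC : F.map (K.d (j - 1) j) ≫ F.map (K.d j (j + 1)) = 0 := by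
    rw [← F.map_comp, K.d_comp_d, F.map_zero]
  have hA : (ShortComplex.mk _ _ zA).Exact := (hS j (j + 1) (j + 1 + 1) rfl rfl).exact
  have hB : (ShortComplex.mk _ _ zB).Exact :=
    (exact_iff_of_epi_iso_mono (S₁ := ShortComplex.mk _ _ zB) (S₂ := ShortComplex.mk _ _ zA)
      (F.map (kernel.lift (K.d j (j + 1)) (K.d (j - 1) j) (K.d_comp_d _ _ _))) (Iso.refl _) (𝟙 _)
      (by simp) (by simp)).2 hA
  have hC : (ShortComplex.mk _ _ zC).Exact :=
    (exact_iff_of_epi_iso_mono (S₁ := ShortComplex.mk _ _ zB) (S₂ := ShortComplex.mk _ _ zC)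
      (𝟙 _) (Iso.refl _) (F.map (kernel.ι (K.d (j + 1) (j + 1 + 1))))
      (by simp [← F.map_comp]) (by simp [← F.map_comp])).1 hB
  rw [HomologicalComplex.exactAt_iff' _ (j - 1) j (j + 1) (by simp) (by simp)]
  exact hC

/-- The pull-back of a mapping cone of complexes of `𝒪_X`-modules is the mapping cone of the pull-backs
(`f^*` is additive). [folklore] -/
def pullbackMappingConeIso (φ : K ⟶ L) :
    ((Scheme.Modules.pullback f).mapHomologicalComplex (ComplexShape.up ℤ)).obj
        (CochainComplex.mappingCone φ) ≅
      CochainComplex.mappingCone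
        (((Scheme.Modules.pullback f).mapHomologicalComplex (ComplexShape.up ℤ)).map φ) :=
  CochainComplex.mappingCone.mapHomologicalComplexIso φ (Scheme.Modules.pullback f)

/-- **`f^*` preserves quasi-isomorphisms between bounded complexes of vector bundles**: the cone of
`f^*φ` is `f^*Cone(φ)`, the pull-back of an acyclic bounded complex of vector bundles, hence acyclic.
(On bounded complexes of vector bundles the naive pull-back is the derived one; Grayson's exact functor
`F` applied to complexes in Definition 1.) [cite: Grayson2013RelativeKTheory, Definition 1]
[cite: Schlichting2011HigherKTheory, §3.1.3] -/
theorem quasiIso_pullback_map (hK : IsBoundedVBComplex K) (hL : IsBoundedVBComplex L) (φ : K ⟶ L)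
    [QuasiIso φ] :
    QuasiIso (((Scheme.Modules.pullback f).mapHomologicalComplex (ComplexShape.up ℤ)).map φ) := by
  rw [quasiIso_iff_acyclic_mappingCone]
  have hac : (CochainComplex.mappingCone φ).Acyclic := (quasiIso_iff_acyclic_mappingCone φ).1 ‹_›
  have h := (hK.mappingCone hL φ).acyclic_pullback f hac
  exact fun i ↦ (quasiIsoAt_iff_exactAt (pullbackMappingConeIso f φ).hom i (h i)).1 inferInstance

end IsBoundedVBComplex

end Literature.AlgebraicGeometry.KTheory

end
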